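import Summits.HubbardSuperconductivity.HubbardSuperconductivity.Theorems.EnslavedA1gGlue
import Summits.HubbardSuperconductivity.HubbardSuperconductivity.Theorems.EnslavedA1gA1gSlavingTransfer
import Summits.HubbardSuperconductivity.HubbardSuperconductivity.Theorems.TwTipContinuation.Negative.TipNormalForm
import Literature.Barriers.HubbardSuperconductivity.PureModelStripeCompetition

/-!
# Crux `BondSingletCondensation` (stmt-HubbardSuperconductivity-0934, route `EnslavedA1g`) —
# STRATEGY CENSUS companion (crux-strategist r1, 2026-08-17): the crux is the summit's NECESSARY size half

Sorry-free. What is proved here (all over the LITERAL route decls):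

* `bondSingletCondensationAt_of_hasDWavePairFieldLROAt` — **S(U,δ) ⇒ C(U,δ) at the SAME (U,δ)**: the
  summit's matrix at `(U,δ)` (every admissible sector-GS sequence has `d`-wave pair-field LRO) forces a
  UNIFORM nearest-neighbour singlet-bond condensate `a = c/2` in every sector ground state at every large even
  side (hard half of `summitMatrix_iff_everyGSOrder` = diagonal of near-worst ground states, then the bond
  parallelogram `Δ_{s'}ᴴΔ_{s'} + Δ_dᴴΔ_d = 2(Δ_hᴴΔ_h + Δ_vᴴΔ_v)` and `Δ_{s'}ᴴΔ_{s'} ≥ 0`).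
* `summit_imp_bondSingletCondensation : HubbardSuperconductivity → BondSingletCondensation` — the route's
  rank-3 crux is a CONSEQUENCE of the summit (the converse probe fails: it needs the A1g exclusion).
* `hasDWavePairFieldLROAt_of_noExtS_of_bond` — **C(U,δ) ∧ NoExtS(U,δ) ⇒ S(U,δ)** pointwise (the route's
  Assembly localised at one `(U,δ)`), hence
  `bondSingletCondensationAt_iff_summitAt_of_noExtS : NoExtS(U,δ) → (C(U,δ) ↔ S(U,δ))` and, with the landed
  `a1gSlavingTransfer_proof`, `bondSingletCondensation_iff_summit_of_noOnsiteODLRO :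
  NoOnsiteODLRO → (BondSingletCondensation ↔ HubbardSuperconductivity)`:
  **modulo the route's OTHER crux (0933, census b1: co-summit) the crux IS the summit.**
* Typed records for the census (defs only): the pointwise A1g-exclusion `NoExtendedSBondLROAt`, the seeded
  family `SeededBondOrderAt` / `BondSeedContinuationAt` (Decomposition D2) and the window strengthening
  `BondSingletCondensationOnWindow` (Strengthen S⁺₂).
-/

noncomputable section

set_option linter.dupNamespace false

namespace Summit.HubbardSuperconductivity.HubbardSuperconductivity.Cruxes.BondSingletCondensation.StrategyCensus

open Matrix Filter Finset
open Literature.MathematicalPhysics.QuantumLattice Literature.Probability.LatticeModels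
open Literature.Barriers.HubbardSuperconductivity (HasDWavePairFieldLROAt)
open Summit.HubbardSuperconductivity.HubbardSuperconductivity.Theses.EnslavedA1g
open Summit.HubbardSuperconductivity.TwTipContinuation.Negative
  (everyGSOrder_of_summitMatrix lroTerm_eq side_pow_pos expect_pairIntensity_le)
open Summit.HubbardSuperconductivity.HubbardSuperconductivity.Theorems.EnslavedA1g
  (bondParallelogram_proof enslavedA1g_assembly_proof)
open scoped ComplexOrder

/-! ## Pointwise forms of the crux and of the A1g exclusion -/

/-- The crux AT `(U,δ)`: a uniform nearest-neighbour singlet-bond condensate `a > 0` in every admissible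
sector-GS sequence, eventually along even sides (the body of `BondSingletCondensation` after `∃ U, ∃ δ`).
[folklore] -/
def BondSingletCondensationAt (U δ : ℝ) : Prop :=
  ∃ a : ℝ, 0 < a ∧ ∀ (N : ℕ → ℕ) (ψ : ∀ L, Fock (Orb (FermionTorus 2 L))),
    (∀ L, Even L → N L = 2 * ⌊(1 - δ) * (L : ℝ) ^ 2 / 2⌋₊ ∧ star (ψ L) ⬝ᵥ ψ L = 1 ∧
        IsGroundStateInSector (hubbardTorus 2 L 1 U) (N L) 0 (ψ L)) →
      ∃ L₀ : ℕ, ∀ (L : ℕ) [NeZero L], Even L → L₀ ≤ L →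
        a ≤ ((expect ((pairField (fun e => (extendedSWave e + dWaveFormFactor e) / 2) L)ᴴ *
                pairField (fun e => (extendedSWave e + dWaveFormFactor e) / 2) L) (ψ L)).re +
              (expect ((pairField (fun e => (extendedSWave e - dWaveFormFactor e) / 2) L)ᴴ *
                pairField (fun e => (extendedSWave e - dWaveFormFactor e) / 2) L) (ψ L)).re) /
            (L : ℝ) ^ 4

/-- Pointwise A1g exclusion AT `(U,δ)`: the extended-`s` (A1g bond) pair-field density tends to `0` along
even sides in every admissible sequence (the conclusion of `A1gSlavingTransfer` at `(U,δ)`). [folklore] -/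
def NoExtendedSBondLROAt (U δ : ℝ) : Prop :=
  ∀ (N : ℕ → ℕ) (ψ : ∀ L, Fock (Orb (FermionTorus 2 L))),
    (∀ L, Even L → N L = 2 * ⌊(1 - δ) * (L : ℝ) ^ 2 / 2⌋₊ ∧ star (ψ L) ⬝ᵥ ψ L = 1 ∧
        IsGroundStateInSector (hubbardTorus 2 L 1 U) (N L) 0 (ψ L)) →
      ∀ ε : ℝ, 0 < ε → ∃ L₀ : ℕ, ∀ (L : ℕ) [NeZero L], Even L → L₀ ≤ L →
        (expect ((pairField extendedSWave L)ᴴ * pairField extendedSWave L) (ψ L)).re / (L : ℝ) ^ 4 ≤ ε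

/-- Unfolding: the crux is `∃ U > 0, ∃ δ ∈ (0,1/2), BondSingletCondensationAt U δ`. [folklore] -/
theorem bondSingletCondensation_iff_exists_at :
    BondSingletCondensation ↔
      ∃ U : ℝ, 0 < U ∧ ∃ δ ∈ Set.Ioo (0 : ℝ) (1 / 2), BondSingletCondensationAt U δ :=
  Iff.rfl

/-- Unfolding: the summit is `∃ U > 0, ∃ δ ∈ (0,1/2), HasDWavePairFieldLROAt U δ`. [folklore] -/
theorem summit_iff_exists_at :
    _root_.HubbardSuperconductivity ↔
      ∃ U : ℝ, 0 < U ∧ ∃ δ ∈ Set.Ioo (0 : ℝ) (1 / 2), HasDWavePairFieldLROAt U δ :=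
  Iff.rfl

/-! ## The parallelogram in expectation -/

/-- `re⟨ψ, Δ_{s'}ᴴΔ_{s'} ψ⟩ ≥ 0`. [folklore] -/
theorem re_expect_extS_nonneg (L : ℕ) [NeZero L] (ψ : Fock (Orb (FermionTorus 2 L))) :
    0 ≤ (expect ((pairField extendedSWave L)ᴴ * pairField extendedSWave L) ψ).re := by
  rw [PosSemidefTrace.expect_conjTranspose_mul, ← norm_toLp_sq_eq_re]
  positivity

/-- **Parallelogram in expectation**: `re⟨Δ_dᴴΔ_d⟩ = 2(re⟨Δ_hᴴΔ_h⟩ + re⟨Δ_vᴴΔ_v⟩) − re⟨Δ_{s'}ᴴΔ_{s'}⟩`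
(from the landed `bondParallelogram_proof`). Scalapino, Phys. Rep. 250 (1995) 329, §2 eq. (2.2). [folklore] -/
theorem re_expect_dWave_eq (L : ℕ) [NeZero L] (ψ : Fock (Orb (FermionTorus 2 L))) :
    (expect ((pairField dWaveFormFactor L)ᴴ * pairField dWaveFormFactor L) ψ).re =
      2 * ((expect ((pairField (fun e => (extendedSWave e + dWaveFormFactor e) / 2) L)ᴴ *
              pairField (fun e => (extendedSWave e + dWaveFormFactor e) / 2) L) ψ).re +
            (expect ((pairField (fun e => (extendedSWave e - dWaveFormFactor e) / 2) L)ᴴ *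
              pairField (fun e => (extendedSWave e - dWaveFormFactor e) / 2) L) ψ).re) -
        (expect ((pairField extendedSWave L)ᴴ * pairField extendedSWave L) ψ).re := by
  have hpar := congrArg (fun X => (expect X ψ).re) (bondParallelogram_proof L)
  simp only [expect_add, expect_smul, Complex.add_re, Complex.mul_re, Complex.re_ofNat,
    Complex.im_ofNat, zero_mul, sub_zero] at hpar
  linarith

/-- **The `d`-wave density is at most twice the bond density**: `re⟨Δ_dᴴΔ_d⟩ ≤ 2(re⟨Δ_hᴴΔ_h⟩ + re⟨Δ_vᴴΔ_v⟩)`.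
[folklore] -/
theorem re_expect_dWave_le_two_mul_bond (L : ℕ) [NeZero L] (ψ : Fock (Orb (FermionTorus 2 L))) :
    (expect ((pairField dWaveFormFactor L)ᴴ * pairField dWaveFormFactor L) ψ).re ≤
      2 * ((expect ((pairField (fun e => (extendedSWave e + dWaveFormFactor e) / 2) L)ᴴ *
              pairField (fun e => (extendedSWave e + dWaveFormFactor e) / 2) L) ψ).re +
            (expect ((pairField (fun e => (extendedSWave e - dWaveFormFactor e) / 2) L)ᴴ *
              pairField (fun e => (extendedSWave e - dWaveFormFactor e) / 2) L) ψ).re) := by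
  have h1 := re_expect_dWave_eq L ψ
  have h2 := re_expect_extS_nonneg L ψ
  linarith

/-! ## S(U,δ) ⇒ C(U,δ): the crux is a necessary condition of the summit, at the same parameters -/

/-- **Summit matrix ⇒ crux, pointwise in `(U,δ)`** (`δ ≥ −1`, in particular every `δ ∈ (0,1/2)`): if every
admissible sector-GS sequence of the pure torus at `(U,δ)` has `d`-wave pair-field LRO, then there is ONE
`a > 0` such that every admissible sequence has nearest-neighbour singlet-bond density `≥ a` at every large
even side. Proof: the hard half of `summitMatrix_iff_everyGSOrder` (a `Nat.findGreatest` diagonal of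
near-worst ground states, no compactness) gives a uniform every-GS floor `cL⁴ ≤ re⟨Δ_dᴴΔ_d⟩`; the
parallelogram gives bond density `≥ c/2`. [folklore] -/
theorem bondSingletCondensationAt_of_hasDWavePairFieldLROAt {U δ : ℝ} (hδ : -1 ≤ δ)
    (hS : HasDWavePairFieldLROAt U δ) : BondSingletCondensationAt U δ := by
  obtain ⟨c, hc, L₀, hL⟩ := everyGSOrder_of_summitMatrix hδ hS
  refine ⟨c / 2, by positivity, fun N ψ hyp => ⟨L₀, fun L _ hE hL₀ => ?_⟩⟩
  obtain ⟨hN, hu, hgs⟩ := hyp L hE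
  rw [hN] at hgs
  have hfloor := hL L hL₀ hE (ψ L) hu hgs
  have hpar := re_expect_dWave_le_two_mul_bond L (ψ L)
  have hLpos : (0 : ℝ) < (L : ℝ) := Nat.cast_pos.2 (Nat.pos_of_ne_zero (NeZero.ne L))
  have hL4 : (0 : ℝ) < (L : ℝ) ^ 4 := by positivity
  rw [le_div_iff₀ hL4]
  linarith

/-- **`HubbardSuperconductivity → BondSingletCondensation`**: the rank-3 crux of route `EnslavedA1g` is
implied by the summit (same witness `(U,δ)`, `a = c/2`). The S → C probe therefore SUCCEEDS as a theorem
(not by `exact?`): the crux is a consequence of the summit — it cannot be refuted without refuting the summit,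
and every proof of the summit proves it. [folklore] -/
theorem summit_imp_bondSingletCondensation :
    _root_.HubbardSuperconductivity → BondSingletCondensation := by
  rintro ⟨U, hU, δ, hδ, hS⟩
  exact ⟨U, hU, δ, hδ, bondSingletCondensationAt_of_hasDWavePairFieldLROAt (by linarith [hδ.1]) hS⟩

/-- Summit-SHAPE form (the hypothesis is `HubbardSuperconductivity` verbatim by `summit_iff_exists_at`; this is
the form proposed for `Theorems/EnslavedA1gBondSingletNecessity.lean`, where no summit constant may sit in a
hypothesis). [folklore] -/
theorem bondSingletCondensation_of_summitShape
    (hS : ∃ U : ℝ, 0 < U ∧ ∃ δ ∈ Set.Ioo (0 : ℝ) (1 / 2), HasDWavePairFieldLROAt U δ) :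
    BondSingletCondensation :=
  summit_imp_bondSingletCondensation (summit_iff_exists_at.2 hS)

/-! ## C(U,δ) ∧ NoExtS(U,δ) ⇒ S(U,δ): the converse needs exactly the A1g exclusion (the other crux) -/

/-- **Crux + pointwise A1g exclusion ⇒ summit matrix, at the same `(U,δ)`** (the route's Assembly
localised): at even sides beyond both thresholds (bond floor `a`, extended-`s` smallness at `ε := a`) the
parallelogram gives `re⟨Δ_dᴴΔ_d⟩ ≥ 2aL⁴ − aL⁴`, and the even-side `liminf` bookkeeping (`lroTerm_eq`, a-priori
cap `expect_pairIntensity_le`) gives `HasLongRangeOrder`. Scalapino, Phys. Rep. 250 (1995) 329, §2 eq. (2.4).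
[folklore] -/
theorem hasDWavePairFieldLROAt_of_noExtS_of_bond {U δ : ℝ} (hno : NoExtendedSBondLROAt U δ)
    (hB : BondSingletCondensationAt U δ) : HasDWavePairFieldLROAt U δ := by
  obtain ⟨a, ha, h⟩ := hB
  intro N ψ hyp
  obtain ⟨L₀, hlow⟩ := h N ψ hyp
  obtain ⟨L₁, hs⟩ := hno N ψ hyp a ha
  -- the d-wave floor at every large even side
  have hfloor : ∀ (L : ℕ) [NeZero L], Even L → max L₀ L₁ ≤ L →
      a * (L : ℝ) ^ 4 ≤ (expect ((pairField dWaveFormFactor L)ᴴ * pairField dWaveFormFactor L)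
        (ψ L)).re := by
    intro L _ hE hL
    have hL' : (0 : ℝ) < (L : ℝ) := Nat.cast_pos.2 (Nat.pos_of_ne_zero (NeZero.ne L))
    have hL4 : (0 : ℝ) < (L : ℝ) ^ 4 := by positivity
    have h1 := hlow L hE (le_trans (le_max_left _ _) hL)
    have h2 := hs L hE (le_trans (le_max_right _ _) hL)
    rw [le_div_iff₀ hL4] at h1
    rw [div_le_iff₀ hL4] at h2
    have hpar := re_expect_dWave_eq L (ψ L)
    linarith
  -- the even-side `liminf` bookkeeping
  change 0 < liminf (fun k : ℕ => (∑ x ∈ halfOpenBox 2 (2 * k), ∑ y ∈ halfOpenBox 2 (2 * k),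
          torusPullback (pairFieldCorr dWaveFormFactor ψ) (2 * k) x y) /
        ((halfOpenBox 2 (2 * k)).card : ℝ) ^ 2) atTop
  have hev : ∀ᶠ k in atTop, a ≤ (∑ x ∈ halfOpenBox 2 (2 * k), ∑ y ∈ halfOpenBox 2 (2 * k),
          torusPullback (pairFieldCorr dWaveFormFactor ψ) (2 * k) x y) /
        ((halfOpenBox 2 (2 * k)).card : ℝ) ^ 2 := by
    refine eventually_atTop.2 ⟨max L₀ L₁ + 1, fun k hk => ?_⟩
    haveI : NeZero (2 * k) := ⟨by omega⟩
    rw [lroTerm_eq, le_div_iff₀ (side_pow_pos k)]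
    exact hfloor (2 * k) (even_two_mul k) (by omega)
  have hev' : ∀ᶠ k in atTop, (∑ x ∈ halfOpenBox 2 (2 * k), ∑ y ∈ halfOpenBox 2 (2 * k),
          torusPullback (pairFieldCorr dWaveFormFactor ψ) (2 * k) x y) /
        ((halfOpenBox 2 (2 * k)).card : ℝ) ^ 2 ≤
      (∑ e ∈ insert 0 unitSteps, ‖((dWaveFormFactor e / Real.sqrt 2 : ℝ) : ℂ)‖ * 2) ^ 2 := by
    refine eventually_atTop.2 ⟨1, fun k hk => ?_⟩
    haveI : NeZero (2 * k) := ⟨by omega⟩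
    obtain ⟨-, hu, -⟩ := hyp (2 * k) (even_two_mul k)
    rw [lroTerm_eq, div_le_iff₀ (side_pow_pos k)]
    exact expect_pairIntensity_le (2 * k) (ψ (2 * k)) hu
  exact lt_of_lt_of_le ha (le_liminf_of_le (isCoboundedUnder_ge_of_eventually_le _ hev') hev)

/-- **Modulo the A1g exclusion at `(U,δ)`, the crux at `(U,δ)` IS the summit's matrix at `(U,δ)`**
(`δ ≥ −1`). [folklore] -/
theorem bondSingletCondensationAt_iff_summitAt_of_noExtS {U δ : ℝ} (hδ : -1 ≤ δ)
    (hno : NoExtendedSBondLROAt U δ) :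
    BondSingletCondensationAt U δ ↔ HasDWavePairFieldLROAt U δ :=
  ⟨hasDWavePairFieldLROAt_of_noExtS_of_bond hno, bondSingletCondensationAt_of_hasDWavePairFieldLROAt hδ⟩

/-- The landed slaving transfer turns the route's rank-2 crux into the pointwise A1g exclusion at every
`(U,δ)`: `NoOnsiteODLRO → NoExtendedSBondLROAt U δ` for `U > 0`, `δ ∈ (0,1/2)`. [folklore] -/
theorem noExtS_of_noOnsiteODLRO (hNo : NoOnsiteODLRO) {U δ : ℝ} (hU : 0 < U)
    (hδ : δ ∈ Set.Ioo (0 : ℝ) (1 / 2)) : NoExtendedSBondLROAt U δ :=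
  fun N ψ hyp => Summit.HubbardSuperconductivity.EnslavedA1g.a1gSlavingTransfer_proof U δ hU hδ N ψ hyp
    (hNo U δ hU hδ N ψ hyp)

/-- **THE COSTUME THEOREM (relative to the route's own frame).** Given the route's OTHER crux
`NoOnsiteODLRO` (stmt-0933; with the landed `a1gSlavingTransfer_proof` it is the A1g exclusion at every
`(U,δ)`), the deciding crux `BondSingletCondensation` is EQUIVALENT to the summit:
`→` is the route's landed Assembly, `←` is `summit_imp_bondSingletCondensation` (unconditional).
So the route reads `S ⟺ C ∧ (A1g exclusion at the witness)`, with `S ⟹ C` outright: `C` is the summit's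
necessary "size half" and carries the whole order-existence content; census b1 (Cruxes/NoOnsiteODLRO/
STRATEGY-CENSUS.md) found the exclusion half co-summit as well. [folklore] -/
theorem bondSingletCondensation_iff_summit_of_noOnsiteODLRO (hNo : NoOnsiteODLRO) :
    BondSingletCondensation ↔ _root_.HubbardSuperconductivity :=
  ⟨fun hB => enslavedA1g_assembly_proof hNo Summit.HubbardSuperconductivity.EnslavedA1g.a1gSlavingTransfer_proof hB,
    summit_imp_bondSingletCondensation⟩

/-- The same via the route's certified deciding theorem `closes`. [folklore] -/
theorem summit_of_bond_of_noOnsiteODLRO (hNo : NoOnsiteODLRO) (hB : BondSingletCondensation) :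
    _root_.HubbardSuperconductivity :=
  Summit.HubbardSuperconductivity.HubbardSuperconductivity.Theses.EnslavedA1g.closes hNo
    Summit.HubbardSuperconductivity.EnslavedA1g.a1gSlavingTransfer_proof hB enslavedA1g_assembly_proof

/-! ## Typed records for the census (no claims; defs only)

* Decomposition D2 (seeded continuation): `SeededBondOrderAt U δ g` — every sector ground state of the
  bond-seeded torus `H − (g/L²)(Δ_hᴴΔ_h + Δ_vᴴΔ_v)` has bond density `≥ a` — is provable for `g` large
  against `8 + U` by a two-line variational argument (the seed is the conclusion: NOT a BC5 witness), and
  `BondSeedContinuationAt U δ` ("order at some seed `g > 0` ⇒ order at seed `0`") is the piece that remains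
  the whole crux (it is `ThermalWedge.TwTipContinuation`'s shape for the bond channel; barrier
  `SourcedOrderWithoutGroundStateLRO` for every source-based packaging).
* Strengthen S⁺₂: `BondSingletCondensationOnWindow` — the crux on a whole parameter box — adds quantifiers,
  no rigidity (ground states at different `(U,δ,L)` are unrelated vectors).
-/

/-- D2, seeded family: every normalised sector ground state of the bond-seeded torus at seed `g` has bond
density `≥ a`, eventually in even `L` (uniformly over ground states). [folklore] -/
def SeededBondOrderAt (U δ g : ℝ) : Prop :=
  ∃ a : ℝ, 0 < a ∧ ∃ L₀ : ℕ, ∀ (L : ℕ) [NeZero L], Even L → L₀ ≤ L →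
    ∀ ψ : Fock (Orb (FermionTorus 2 L)), star ψ ⬝ᵥ ψ = 1 →
      IsGroundStateInSector
          (hubbardTorus 2 L 1 U - ((g / (L : ℝ) ^ 2 : ℝ) : ℂ) •
            ((pairField (fun e => (extendedSWave e + dWaveFormFactor e) / 2) L)ᴴ *
                pairField (fun e => (extendedSWave e + dWaveFormFactor e) / 2) L +
              (pairField (fun e => (extendedSWave e - dWaveFormFactor e) / 2) L)ᴴ *
                pairField (fun e => (extendedSWave e - dWaveFormFactor e) / 2) L))
          (2 * ⌊(1 - δ) * (L : ℝ) ^ 2 / 2⌋₊) 0 ψ →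
        a * (L : ℝ) ^ 4 ≤
          ((expect ((pairField (fun e => (extendedSWave e + dWaveFormFactor e) / 2) L)ᴴ *
                pairField (fun e => (extendedSWave e + dWaveFormFactor e) / 2) L) ψ).re +
            (expect ((pairField (fun e => (extendedSWave e - dWaveFormFactor e) / 2) L)ᴴ *
                pairField (fun e => (extendedSWave e - dWaveFormFactor e) / 2) L) ψ).re)

/-- D2, the continuation piece (the piece that remains the whole crux): bond order at SOME seed `g > 0`
implies the crux at `(U,δ)` (seed `0`). [folklore] -/
def BondSeedContinuationAt (U δ : ℝ) : Prop :=
  (∃ g : ℝ, 0 < g ∧ SeededBondOrderAt U δ g) → BondSingletCondensationAt U δ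

/-- S⁺₂, window strengthening: the crux on a whole box `[U₁,U₂] × [δ₁,δ₂]` with one constant. [folklore] -/
def BondSingletCondensationOnWindow (U₁ U₂ δ₁ δ₂ : ℝ) : Prop :=
  ∃ a : ℝ, 0 < a ∧ ∀ U ∈ Set.Icc U₁ U₂, ∀ δ ∈ Set.Icc δ₁ δ₂,
    ∀ (N : ℕ → ℕ) (ψ : ∀ L, Fock (Orb (FermionTorus 2 L))),
      (∀ L, Even L → N L = 2 * ⌊(1 - δ) * (L : ℝ) ^ 2 / 2⌋₊ ∧ star (ψ L) ⬝ᵥ ψ L = 1 ∧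
          IsGroundStateInSector (hubbardTorus 2 L 1 U) (N L) 0 (ψ L)) →
        ∃ L₀ : ℕ, ∀ (L : ℕ) [NeZero L], Even L → L₀ ≤ L →
          a ≤ ((expect ((pairField (fun e => (extendedSWave e + dWaveFormFactor e) / 2) L)ᴴ *
                  pairField (fun e => (extendedSWave e + dWaveFormFactor e) / 2) L) (ψ L)).re +
                (expect ((pairField (fun e => (extendedSWave e - dWaveFormFactor e) / 2) L)ᴴ *
                  pairField (fun e => (extendedSWave e - dWaveFormFactor e) / 2) L) (ψ L)).re) /
              (L : ℝ) ^ 4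

/-- S⁺₂ is only bookkeeping-stronger: it gives the crux at any interior point of a box meeting
`(0,∞) × (0,1/2)`. [folklore] -/
theorem bondSingletCondensation_of_window {U₁ U₂ δ₁ δ₂ : ℝ} (hU : 0 < U₁) (hUU : U₁ ≤ U₂)
    (hδ : 0 < δ₁) (hδδ : δ₁ ≤ δ₂) (hδ2 : δ₂ < 1 / 2)
    (h : BondSingletCondensationOnWindow U₁ U₂ δ₁ δ₂) : BondSingletCondensation := by
  obtain ⟨a, ha, hbox⟩ := h
  exact ⟨U₁, hU, δ₁, ⟨hδ, by linarith⟩, a, ha,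
    hbox U₁ ⟨le_rfl, hUU⟩ δ₁ ⟨le_rfl, hδδ⟩⟩

end Summit.HubbardSuperconductivity.HubbardSuperconductivity.Cruxes.BondSingletCondensation.StrategyCensus
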